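import Summits.BirchSwinnertonDyer.BirchSwinnertonDyer.Theorems.SignedLowerHalvesKobayashiLowerHalfSemistableDefmuAssembly
import HarnessLib

/-!
# Line «defmu» of crux 2 `KobayashiLowerHalfSemistable` (stmt-BirchSwinnertonDyer-19000): what the line proves is the FULL
# signed main conjecture for BOTH signs at X6, `5 ≤ p` (not only the crux's `∃ ε` Eisenstein half)

Route-independent `Theorems` file of the cell `bsd-ssimc`, seat `bsd-line-slh-p2` (LEAD of crux 2, gen 9); companion of
`…DefmuAssembly.lean` (p629660) and `…DefmuAssemblyStubs.lean` (p630247). HONEST FRAMING: nothing about any curve is asserted,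
NO summit statement is proved, BSD / the crux is NOT proved; both theorems are IMPLICATIONS from hypotheses displayed in full.

The assembly's `exists_kobayashiLowerDivisibility_of_package` instantiates the package hypothesis Cμ at the sign `ε = 1` and
keeps only the Eisenstein half. But Cμ is quantified over EVERY sign `ε : ℤˣ`, and the descent
`SemistableDefmuAssembly.kobayashiMainConjecture_of_twoVariableDvd` returns Kobayashi's main conjecture as an EQUALITY of ideals
(`KobayashiMainConjecture W p ε`: `X^ε` torsion and `char X^ε = (ϖ · L^ε_p)`), so the same hypotheses give more, recorded here for
the consumers that need a SPECIFIC sign or the equality (rank-`0` `p`-part `X6.bsdp_of_kobayashiMainConjecture_of_analyticRank_eq_zero`,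
the rank cuts of `…SemistableRankCut`, crux 4's small-image equality shape):
* `kobayashiMainConjecture_of_package` — S1aʳ (`stub_ramifiedLevelPrimeR` signature VERBATIM) ⊕ Cμ (`stub_definitePackageMu`
  signature VERBATIM) ⊕ the six named facts of `NamedInputs₂` ⟹ ∀ (W, p) on X6 with `5 ≤ p`, ∀ ε, `KobayashiMainConjecture W p ε`;
* `kobayashiMainConjecture_of_levelLowering` — the same with S1aʳ supplied from modularity `exists_isNewformOf` and Diamond 1995 /
  Ribet 1990 level lowering `diamond1995_refinedSerre` (`SemistableDefiniteFrameData.ramifiedLevelPrimeR_of_levelLowering`, p625644):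
  EIGHT named facts ⊕ ONE unfolded hypothesis Cμ ⟹ Kobayashi's main conjecture for both signs on X6 at `5 ≤ p`.
Proofs = the assembly's `exists_kobayashiLowerDivisibility_of_package` with the sign threaded (crux workfile §10, ideator bsd-idea-13
rev 5). Kernel state of the crux after this file: UNCHANGED (OPEN; PRE). Nothing of BSTW is asserted.

References: [BurungaleSkinnerTianWan2024] arXiv:2409.01350v2 §2.3 proof of Thm. (KoMC_r), Props. 1.18/2.7/5.19, Thm. 6.17, Thm. 9.24;
[Kobayashi2003] Conj. (p. 2), Thm. 1.2, Thm. 4.1; [Ribet1990] Thm. 1.1; [Diamond1995RefinedSerre] Thm. 1.1; [PollackWeston2011] Thm. 2.5.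
-/

-- D-0017: single-problem summit, the namespace repeats the problem name by design.
set_option linter.dupNamespace false
set_option autoImplicit false

noncomputable section

open scoped Classical

open NumberField IsDedekindDomain Field CongruenceSubgroup
open Literature.NumberTheory.GaloisRepresentations
open Literature.NumberTheory.EllipticCurves Literature.NumberTheory.EllipticCurves.BurungaleSkinnerTianWan2024
open Literature.NumberTheory.EllipticCurves.ModularForms

namespace Summit.BirchSwinnertonDyer.BirchSwinnertonDyer.Theorems.SemistableDefmuAssemblyMainConjecture

open Summit.BirchSwinnertonDyer.BirchSwinnertonDyer.Theorems.SignedBaseChangeK2RTransferDescent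
open Summit.BirchSwinnertonDyer.BirchSwinnertonDyer.Theorems.SemistableDefmuAssembly

/-- **Kobayashi's signed main conjecture for BOTH signs on X6 at `5 ≤ p`, from S1aʳ ⊕ Cμ ⊕ six named facts.** For every
globally minimal `W/ℚ`, prime `p ≠ 2` with `ClassX6 W p`, `5 ≤ p`, and every sign `ε`: `KobayashiMainConjecture W p ε` (`X^ε(E/ℚ_∞)`
is `Λ`-torsion and `char X^ε = (ϖ · L^ε_p(E))`, Néron normalisation), GRANTED `h1a` (= registered stub `stub_ramifiedLevelPrimeR`
verbatim; PUB, tree-conditional p625644), `hC` (= registered HARD stub `stub_definitePackageMu` verbatim; PRE ⊕ PUB ⊕ one comparison)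
and the named facts `h617` (BSTW Thm 6.17 frames, PRE binder), `h12`/`h41` (Kobayashi Thms 1.2/4.1), `hmod` (modularity datum), `hper`
(period unit), `h924` (GMC_r = BSTW Thm 9.24, OPEN binder). Proof = `SemistableDefmuAssembly.exists_kobayashiLowerDivisibility_of_package`
with the sign `ε` threaded through Cμ and the descent. CONDITIONAL (`conditional-result`); closes nothing.
[cite: BurungaleSkinnerTianWan2024, §2.3 proof of Thm. (KoMC_r)] [cite: Kobayashi2003, Conjecture (Main Conjecture) (p. 2), Thm. 1.2, Thm. 4.1] -/
theorem kobayashiMainConjecture_of_package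
    (h1a :
      ∀ (p : ℕ) [Fact p.Prime] (W : WeierstrassCurve ℚ) [W.IsElliptic] [W.IsGloballyMinimal],
        5 ≤ p → Rank1Residual.ClassX6 W p →
        ∃ q₀ : ℕ, q₀.Prime ∧ (q₀ : ℤ) ∣ W.conductorNorm ℤ ∧ ¬ ((p : ℤ) ∣ padicValRat q₀ W.Δ))
    (hC :
      ∀ {p : ℕ} [Fact p.Prime] (ι : PadicAlgCl p ≃+* ℂ) (W : WeierstrassCurve ℚ) [W.IsElliptic]
        [W.IsGloballyMinimal] (K : Type) [Field K] [NumberField K] (v vbar : HeightOneSpectrum (𝓞 K))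
        (κ₁ κ₂ : ZpExtension K p) (γ₁ γ₂ : absoluteGaloisGroup K)
        [Fact (ZpExtension.IsTopGeneratorPair κ₁ κ₂ γ₁ γ₂)] {N : ℕ} [NeZero N] (f : CuspForm (Gamma0 N) 2)
        [NeZero (NumberField.discr K).natAbs],
        IsNewformOf W f → (N : ℤ) = W.conductorNorm ℤ → p ≠ 2 → ¬ (p : ℤ) ∣ W.conductorNorm ℤ →
        W.frobeniusTrace p = 0 →
        IsImaginaryQuadratic K → ((Ideal.span {(p : ℤ)}).primesOver (𝓞 K)).ncard = 2 →
        ((p : ℕ) : 𝓞 K) ∈ v.asIdeal → ((p : ℕ) : 𝓞 K) ∈ vbar.asIdeal → vbar ≠ v →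
        (∀ (w : InfinitePlace K) (k : 𝓞 K), k ∈ v.asIdeal ↔ ‖ι.symm (w.embedding (k : K))‖ < 1) →
        IsCoprime (N : ℤ) (NumberField.discr K) →
        -- ⟨definite-CR datum, rev 5: X6 at 5 ≤ p; ONE prime q₀ ∥ N inert in K, every other ℓ ∣ N split; `2` split or
        --  `2 ∣ N` ((spl) of BSTW Thm 9.24); (CR, RAMIFIED branch only) `p ∤ v_{q₀}(Δ_W)` (ρ̄ ramified at q₀, `p ∤ c_{q₀}`)⟩
        5 ≤ p → Rank1Residual.ClassX6 W p →
        ∀ q₀ : ℕ, q₀.Prime → q₀ ∣ N → ¬ (q₀ ^ 2 ∣ N) →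
          ((Ideal.span {(q₀ : ℤ)}).primesOver (𝓞 K)).ncard = 1 →
          (∀ ℓ : ℕ, ℓ.Prime → ℓ ∣ N → ℓ ≠ q₀ → ((Ideal.span {(ℓ : ℤ)}).primesOver (𝓞 K)).ncard = 2) →
          (((Ideal.span {(2 : ℤ)}).primesOver (𝓞 K)).ncard = 2 ∨ 2 ∣ N) →
          ¬ ((p : ℤ) ∣ padicValRat q₀ W.Δ) →
        (∀ ρ : ModPGaloisRep K (ZMod p) 2, (W.baseChange K).IsTorsionGaloisRep p ρ →
          FramedRep.IsAbsolutelyIrreducible ρ) →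
        κ₁.IsCyclotomic → κ₂.IsAnticyclotomic →
        ∀ (Ω δ : ℂ) (Ωp : (unrIntegers p)ˣ) (LK G : PowerSeries (PowerSeries (PadicComplexInt p))),
          Ω ≠ 0 → (δ ^ 2 = (NumberField.discr K : ℂ) ∨ δ ^ 2 = -(NumberField.discr K : ℂ)) →
          IsKatzMeasure₂ ι v vbar ∅ κ₁ κ₂ γ₁⁻¹ γ₂⁻¹ 1 Ω δ ((Ωp : unrIntegers p) : PadicComplex p) LK →
          IsGreenbergLFunctionAnyRoot₂ ι v vbar κ₁ κ₂ γ₁⁻¹ γ₂⁻¹ f (NumberField.discr K).natAbs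
            (NumberField.classNumber K) LK G →
        ∀ J : ℤ_[p] →+* PadicComplexInt p,
          (∀ x : ℤ_[p], ((J x : PadicComplexInt p) : PadicComplex p) = ((x : ℚ_[p]) : PadicComplex p)) →
        ∀ ε : ℤˣ,
        ∃ xi Lsig : PowerSeries (PowerSeries (PadicComplexInt p)),
          GreenbergVatsal2000.HasUnitContent (UnrSeries₂.minus Lsig) ∧
          (Ideal.span {xi * G} =
              (WeierstrassCurve.XGr₂.charIdeal (W.baseChange K) p κ₁ κ₂ vbar γ₁ γ₂).map
                  (IwasawaAlgebra₂.toUnr₂ p J) * Ideal.span {Lsig} ∧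
          ∀ (κ : ZpExtension ℚ p) (γ : absoluteGaloisGroup ℚ), κ.IsCyclotomic → κ.IsTopGenerator γ →
            IsCyclotomicVariable p γ →
            (∃ ζ : ℤ_[p]ˣ, IsOfFinOrder ζ ∧
              GaloisRep.cyclotomicCharacter ℚ p γ * ζ = GaloisRep.cyclotomicCharacter K p γ₁) →
            ∀ (W₂ : WeierstrassCurve ℚ) [W₂.IsElliptic] [W₂.IsGloballyMinimal]
              (C₂ : WeierstrassCurve.VariableChange ℚ),
              C₂ • W₂ = W.quadraticTwist (NumberField.discr K : ℚ) →
              (∀ (D₁ : Kobayashi2003.SignedSelmerDualData W κ γ ε)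
                  (D₂ : Kobayashi2003.SignedSelmerDualData W₂ κ γ ε) (g₁ g₂ : IwasawaAlgebra p),
                  D₁.charIdeal = Ideal.span {g₁} → D₂.charIdeal = Ideal.span {g₂} →
                  UnrSeries₂.plus xi ∣ PowerSeries.map J (g₁ * g₂)) ∧
              (∀ {N₂ : ℕ} [NeZero N₂] (f₂ : CuspForm (Gamma0 N₂) 2), IsNewformOf W₂ f₂ →
                ∀ (L₁ L₂ : IwasawaAlgebra p), Kobayashi2003.IsSignedPAdicLFunction f p ε L₁ →
                  Kobayashi2003.IsSignedPAdicLFunction f₂ p ε L₂ →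
                  ∃ u : PowerSeries (PadicComplexInt p), IsUnit u ∧
                    UnrSeries₂.plus Lsig = u * PowerSeries.map J (L₁ * L₂))))
    (h617 : thm617_exists_isGreenbergLFunctionAnyRoot₂_supersingular_PRE)
    (h12 : Kobayashi2003.thm12_signedSelmerDual_finite_torsion)
    (h41 : Kobayashi2003.thm41_signedCharIdeal_divisibility)
    (hmod : nonempty_modularParametrizationData)
    (hper : realPeriodRat_eq_unit_mul_plusPeriod)
    (h924 : thm924_greenberg_dvd_charIdealXGr₂_awayFromCyc_OPEN)
    (W : WeierstrassCurve ℚ) [W.IsElliptic] [W.IsGloballyMinimal] (p : ℕ) [Fact p.Prime]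
    (hp : p ≠ 2) (hX : Rank1Residual.ClassX6 W p) (h5p : 5 ≤ p) (ε : ℤˣ) :
    Summit.BirchSwinnertonDyer.Rank1Residual.Supersingular.KobayashiMainConjecture W p ε := by
  haveI : NeZero (W.conductorNorm ℤ) := ⟨(W.conductorNorm_pos_holds).ne'⟩
  obtain ⟨π⟩ := hmod W
  -- the local facts at `p` read off the class, and square-freeness of `N_W` from semistability
  have hgood : W.HasGoodReductionAtPrime p := hX.1.1
  have hpN' : ¬ p ∣ W.conductorNorm ℤ := not_dvd_conductorNorm_of_hasGoodReductionAtPrime W hgood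
  have hpN : ¬ (p : ℤ) ∣ W.conductorNorm ℤ := by exact_mod_cast hpN'
  have ha0 : W.frobeniusTrace p = 0 := (W.natCast_dvd_frobeniusTrace_iff_eq_zero p h5p hgood).mp hX.1.2
  have hN : ((W.conductorNorm ℤ : ℕ) : ℤ) = W.conductorNorm ℤ := rfl
  have hsq : Squarefree (W.conductorNorm ℤ) :=
    (W.isSemistable_iff_squarefree_conductorNorm).mp ((Rank1Residual.semistable_iff_isSemistable_int W).mp hX.2.1)
  -- S1aʳ: the ramified level prime; S1bʳ: the definite datum with this `q₀` inert
  obtain ⟨q₀, hq₀, hqN, hCR⟩ := h1a p W h5p hX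
  obtain ⟨K, _, _, ι, v, vbar, κ₁, κ₂, γ₁, γ₂, _, _, hIQ, hsp, hv, hvbar, hvv, hι, hcop, hq₀', hqN', hq2, hin, hspl,
    h2K, hCR', hirr, hκ₁, hκ₂, hcan⟩ := SemistableDefiniteFrameData.definiteFieldSupplyFromR p W (W.conductorNorm ℤ) hN h5p hX q₀ hq₀ hqN hCR
  -- a Katz/Greenberg frame for `π.f` over `K`, and a structure map `J`
  obtain ⟨Ω, δ, Ωp, LK, G, hΩ, hδ, hLK, hGr⟩ :=
    h617 ι W K v vbar κ₁ κ₂ γ₁ γ₂ π.isNewformOf hN h5p hpN ha0 hIQ hsp hv hvbar hvv hι hcop hκ₁ hκ₂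
  obtain ⟨J, hJ⟩ := exists_structureMap_padicInt (p := p)
  -- Cμ: the package with unit content on the anticyclotomic line, for the sign `ε`
  obtain ⟨xi, Lsig, hμ, hP1, hline⟩ := hC ι W K v vbar κ₁ κ₂ γ₁ γ₂ π.f π.isNewformOf hN hp hpN ha0 hIQ hsp hv hvbar
    hvv hι hcop h5p hX q₀ hq₀' hqN' hq2 hin hspl h2K hCR' hirr hκ₁ hκ₂ Ω δ Ωp LK G hΩ hδ hLK hGr J hJ ε
  -- GMC_r (BSTW Thm 9.24, BY NAME): the cyclotomic-variable witness `s`; (spl) from `q₀` inert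
  obtain ⟨s, hs, hle⟩ := h924 ι W K v vbar κ₁ κ₂ γ₁ γ₂ π.isNewformOf hN hsq hp hpN' hIQ hsp hv hvbar hvv hι hcop
    hirr ⟨q₀, hq₀', hqN', by rw [hin]; decide⟩ h2K hκ₁ hκ₂ Ω δ Ωp LK G hΩ hδ hLK hGr J hJ
  -- `G ≠ 0` is free: (P1), `ch ≠ ⊥`, `𝓛^∘ ≠ 0`
  have hLs : Lsig ≠ 0 := ne_zero_of_hasUnitContent_minus hμ
  have hG0 : G ≠ 0 :=
    ne_zero_of_span_mul_eq hP1 (map_charIdealXGr₂_ne_bot _ κ₁ κ₂ vbar γ₁ γ₂ (structureMap_injective hJ)) hLs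
  -- the μ-transfer: `𝓛^∘ ∣ ξ_∘` two-variably
  have hdvd : Lsig ∣ xi := dvd_of_awayFromCyc_of_package hμ hs hle hP1 hG0
  -- S5ʳ: descend and squeeze
  exact kobayashiMainConjecture_of_twoVariableDvd h12 h41 hmod hper ι W K v vbar κ₁ κ₂ γ₁ γ₂ π.f π.isNewformOf hN hp hpN ha0 hIQ hsp hv
    hvbar hvv hι hcop h5p hX hirr hκ₁ hκ₂ hcan Ω δ Ωp LK G hΩ hδ hLK hGr J hJ ε xi Lsig hdvd ⟨hP1, hline⟩

/-- **The sharpest NAMED form: EIGHT named facts ⊕ ONE unfolded hypothesis Cμ ⟹ Kobayashi's main conjecture for BOTH signs on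
X6 at `5 ≤ p`.** S1aʳ from modularity `exists_isNewformOf` (`hmodN`) and Diamond 1995 / Ribet 1990 level lowering
`diamond1995_refinedSerre` (`hLL`) via `SemistableDefiniteFrameData.ramifiedLevelPrimeR_of_levelLowering` (p625644); the other six
named facts as in `kobayashiMainConjecture_of_package`; `hC` = the registered stub `stub_definitePackageMu` verbatim (PRE ⊕ PUB ⊕ one
comparison; not reducible to the tree's binder `props118_27_519_exists_signedTwoVariablePackage_supersingular_PRE` as typed).
CONDITIONAL; closes nothing. [cite: Ribet1990, Thm. 1.1] [cite: Diamond1995RefinedSerre, Thm. 1.1]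
[cite: BurungaleSkinnerTianWan2024, §2.3 proof of Thm. (KoMC_r)] [cite: Kobayashi2003, Conjecture (Main Conjecture) (p. 2)] -/
theorem kobayashiMainConjecture_of_levelLowering (hmodN : ModularForms.exists_isNewformOf)
    (hLL : Literature.NumberTheory.Automorphic.diamond1995_refinedSerre)
    (hC :
      ∀ {p : ℕ} [Fact p.Prime] (ι : PadicAlgCl p ≃+* ℂ) (W : WeierstrassCurve ℚ) [W.IsElliptic]
        [W.IsGloballyMinimal] (K : Type) [Field K] [NumberField K] (v vbar : HeightOneSpectrum (𝓞 K))
        (κ₁ κ₂ : ZpExtension K p) (γ₁ γ₂ : absoluteGaloisGroup K)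
        [Fact (ZpExtension.IsTopGeneratorPair κ₁ κ₂ γ₁ γ₂)] {N : ℕ} [NeZero N] (f : CuspForm (Gamma0 N) 2)
        [NeZero (NumberField.discr K).natAbs],
        IsNewformOf W f → (N : ℤ) = W.conductorNorm ℤ → p ≠ 2 → ¬ (p : ℤ) ∣ W.conductorNorm ℤ →
        W.frobeniusTrace p = 0 →
        IsImaginaryQuadratic K → ((Ideal.span {(p : ℤ)}).primesOver (𝓞 K)).ncard = 2 →
        ((p : ℕ) : 𝓞 K) ∈ v.asIdeal → ((p : ℕ) : 𝓞 K) ∈ vbar.asIdeal → vbar ≠ v →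
        (∀ (w : InfinitePlace K) (k : 𝓞 K), k ∈ v.asIdeal ↔ ‖ι.symm (w.embedding (k : K))‖ < 1) →
        IsCoprime (N : ℤ) (NumberField.discr K) →
        -- ⟨definite-CR datum, rev 5: X6 at 5 ≤ p; ONE prime q₀ ∥ N inert in K, every other ℓ ∣ N split; `2` split or
        --  `2 ∣ N` ((spl) of BSTW Thm 9.24); (CR, RAMIFIED branch only) `p ∤ v_{q₀}(Δ_W)` (ρ̄ ramified at q₀, `p ∤ c_{q₀}`)⟩
        5 ≤ p → Rank1Residual.ClassX6 W p →
        ∀ q₀ : ℕ, q₀.Prime → q₀ ∣ N → ¬ (q₀ ^ 2 ∣ N) →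
          ((Ideal.span {(q₀ : ℤ)}).primesOver (𝓞 K)).ncard = 1 →
          (∀ ℓ : ℕ, ℓ.Prime → ℓ ∣ N → ℓ ≠ q₀ → ((Ideal.span {(ℓ : ℤ)}).primesOver (𝓞 K)).ncard = 2) →
          (((Ideal.span {(2 : ℤ)}).primesOver (𝓞 K)).ncard = 2 ∨ 2 ∣ N) →
          ¬ ((p : ℤ) ∣ padicValRat q₀ W.Δ) →
        (∀ ρ : ModPGaloisRep K (ZMod p) 2, (W.baseChange K).IsTorsionGaloisRep p ρ →
          FramedRep.IsAbsolutelyIrreducible ρ) →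
        κ₁.IsCyclotomic → κ₂.IsAnticyclotomic →
        ∀ (Ω δ : ℂ) (Ωp : (unrIntegers p)ˣ) (LK G : PowerSeries (PowerSeries (PadicComplexInt p))),
          Ω ≠ 0 → (δ ^ 2 = (NumberField.discr K : ℂ) ∨ δ ^ 2 = -(NumberField.discr K : ℂ)) →
          IsKatzMeasure₂ ι v vbar ∅ κ₁ κ₂ γ₁⁻¹ γ₂⁻¹ 1 Ω δ ((Ωp : unrIntegers p) : PadicComplex p) LK →
          IsGreenbergLFunctionAnyRoot₂ ι v vbar κ₁ κ₂ γ₁⁻¹ γ₂⁻¹ f (NumberField.discr K).natAbs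
            (NumberField.classNumber K) LK G →
        ∀ J : ℤ_[p] →+* PadicComplexInt p,
          (∀ x : ℤ_[p], ((J x : PadicComplexInt p) : PadicComplex p) = ((x : ℚ_[p]) : PadicComplex p)) →
        ∀ ε : ℤˣ,
        ∃ xi Lsig : PowerSeries (PowerSeries (PadicComplexInt p)),
          GreenbergVatsal2000.HasUnitContent (UnrSeries₂.minus Lsig) ∧
          (Ideal.span {xi * G} =
              (WeierstrassCurve.XGr₂.charIdeal (W.baseChange K) p κ₁ κ₂ vbar γ₁ γ₂).map
                  (IwasawaAlgebra₂.toUnr₂ p J) * Ideal.span {Lsig} ∧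
          ∀ (κ : ZpExtension ℚ p) (γ : absoluteGaloisGroup ℚ), κ.IsCyclotomic → κ.IsTopGenerator γ →
            IsCyclotomicVariable p γ →
            (∃ ζ : ℤ_[p]ˣ, IsOfFinOrder ζ ∧
              GaloisRep.cyclotomicCharacter ℚ p γ * ζ = GaloisRep.cyclotomicCharacter K p γ₁) →
            ∀ (W₂ : WeierstrassCurve ℚ) [W₂.IsElliptic] [W₂.IsGloballyMinimal]
              (C₂ : WeierstrassCurve.VariableChange ℚ),
              C₂ • W₂ = W.quadraticTwist (NumberField.discr K : ℚ) →
              (∀ (D₁ : Kobayashi2003.SignedSelmerDualData W κ γ ε)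
                  (D₂ : Kobayashi2003.SignedSelmerDualData W₂ κ γ ε) (g₁ g₂ : IwasawaAlgebra p),
                  D₁.charIdeal = Ideal.span {g₁} → D₂.charIdeal = Ideal.span {g₂} →
                  UnrSeries₂.plus xi ∣ PowerSeries.map J (g₁ * g₂)) ∧
              (∀ {N₂ : ℕ} [NeZero N₂] (f₂ : CuspForm (Gamma0 N₂) 2), IsNewformOf W₂ f₂ →
                ∀ (L₁ L₂ : IwasawaAlgebra p), Kobayashi2003.IsSignedPAdicLFunction f p ε L₁ →
                  Kobayashi2003.IsSignedPAdicLFunction f₂ p ε L₂ →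
                  ∃ u : PowerSeries (PadicComplexInt p), IsUnit u ∧
                    UnrSeries₂.plus Lsig = u * PowerSeries.map J (L₁ * L₂))))
    (h617 : thm617_exists_isGreenbergLFunctionAnyRoot₂_supersingular_PRE)
    (h12 : Kobayashi2003.thm12_signedSelmerDual_finite_torsion)
    (h41 : Kobayashi2003.thm41_signedCharIdeal_divisibility)
    (hmod : nonempty_modularParametrizationData)
    (hper : realPeriodRat_eq_unit_mul_plusPeriod)
    (h924 : thm924_greenberg_dvd_charIdealXGr₂_awayFromCyc_OPEN)
    (W : WeierstrassCurve ℚ) [W.IsElliptic] [W.IsGloballyMinimal] (p : ℕ) [Fact p.Prime]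
    (hp : p ≠ 2) (hX : Rank1Residual.ClassX6 W p) (h5p : 5 ≤ p) (ε : ℤˣ) :
    Summit.BirchSwinnertonDyer.Rank1Residual.Supersingular.KobayashiMainConjecture W p ε :=
  kobayashiMainConjecture_of_package (SemistableDefiniteFrameData.ramifiedLevelPrimeR_of_levelLowering hmodN hLL) hC h617
    h12 h41 hmod hper h924 W p hp hX h5p ε

end Summit.BirchSwinnertonDyer.BirchSwinnertonDyer.Theorems.SemistableDefmuAssemblyMainConjecture

end
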